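import Summits.BirchSwinnertonDyer.BirchSwinnertonDyer.Theorems.GenusKolyvaginAtTwoOffCutResidualAtTwoRSocleSelectionHeegnerSocle
import Summits.BirchSwinnertonDyer.BirchSwinnertonDyer.Theorems.GenusKolyvaginAtTwoVisiblePairAtTwoHeegnerClassKummer
import Summits.BirchSwinnertonDyer.BirchSwinnertonDyer.Theorems.GenusKolyvaginAtTwoVisiblePairAtTwoInjective
import Summits.BirchSwinnertonDyer.BirchSwinnertonDyer.Theorems.GenusKolyvaginAtTwoVisiblePairAtTwoVisibility
import Summits.BirchSwinnertonDyer.BirchSwinnertonDyer.Theorems.GenusKolyvaginAtTwoPowDvdShaCardAtTwoRTKolyvaginClassLevels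
import Summits.BirchSwinnertonDyer.BirchSwinnertonDyer.Theorems.GenusKolyvaginAtTwoShaCardDvdPowAtTwoRTDescentAtTransposition
import Literature.NumberTheory.EllipticCurves.TwoTorsionOddDegreeBaseChangeProofs
import HarnessLib

/-!
# Route `GenusKolyvaginAtTwo`, residual `OffCutResidualAtTwoR` (stmt-BirchSwinnertonDyer-31767), LINE 27 «socle_selection» STUB S2 —
# THE (SOC) CONJUNCT VERBATIM on the `2`-split half of the shallow `Δ > 0` frame: the Selmer socle and the Heegner socle COINCIDE

LEAD seat `bsd-line-gk2-p1` g25 (cell `bsd-f1-sign2`), `--supports stmt-BirchSwinnertonDyer-31767 --as helper`; sequel of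
`…SocleSelectionHeegnerSocle` (narrowness automatic; real-trivial line = twin's Selmer group = capitulation kernel).  THEOREMS ONLY (no definition,
no named fact, no `sorry`).  **BSD is NOT proved by this file; `OffCutResidualAtTwoR`, K4Pos and crux 25504 are NOT proved; S2 is NOT closed: its (HL)
conjunct remains (gk2-p4 g30), and the statement below carries ONE extra binder «`2` split in `K`» w.r.t. `stub_shallowFrameSocle` (the `2`-inert half
needs the prime-twist dictionary at an inert `2`, not in the tree).**

* §3b `resTorsion_eq_kummer_of_realTrivial` / `realTrivial_of_resTorsion_eq_kummer` (the two names announced in file 1's docstring live HERE): on the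
  frame with ranks `rank Wd(ℚ) = rank E(K) = 1`, a non-zero real-trivial Selmer class restricts to `κ₂(Q₀)` for any `Q₀ ∉ 2E(K)`, and the unique
  descent `s_y` of `κ₂(Q₀)` IS real-trivial — capitulation kernel = real-trivial line = twin's Selmer group, element by element.
* `pow_zsmul_kolyvaginClass_one_eq_torsionH1OfDvd_kummer` — THE HEEGNER SOCLE: `2^(M − M₀ − 1) • ι_{M→M+1} c_M(1) = ι_{1→M+1} κ₂(y_K/2^{M₀})`
  (`c_M(1) = κ_{2^M}(P₀)`, gk2's `VisiblePairAtTwo.kolyvaginClass_one_two_eq_kummerMapTorsion`; McCallum's Lemma 4.6 in the tree's `KolyvaginClassLevels`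
  currency; the Kummer analogue `k • κ_n(Q) = ι κ_d(Q)` through an admissible `A ∋ Q`).
* **`sharedSocle_of_realTrivialSocle_of_splitTwo`** — (SOC) of `stub_shallowFrameSocle` VERBATIM + `((Ideal.span {2}).primesOver (𝓞 K)).ncard = 2`:
  for `M ≥ M₀ + 1` and `s₀ ∈ Sel_(2^M)(E/ℚ)` whose socle is the level-raise of a non-zero REAL-TRIVIAL class `c`, the lines `⟨ι res_K s₀⟩` and
  `⟨ι c_M(1)⟩` share their socle one level up.  Mechanism: `c ∈ Sel₂(E)` (level-stability of local kernels) ⇒ `c` is THE capitulating class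
  (file 1: `res_K c = κ₂(Q₀)`, ranks `0 + 1` by PRINT `MultPublishedInputsAtTwo`) ⇒ both socles equal `ι_{1→M+1} κ₂(Q₀) ≠ 0`.
With LEAD g24's (RTV) p775515 this leaves (HL) as the only open conjunct of S2 on the `2`-split half.  BSD is NOT proved by any of this.
References: [GrossLMS1991] §4 (4.4), §5 (5.1); [McCallumLMS1991] §4 (6), Lemma 4.6, §5 Lemma 5.1; [Kramer1981] Thm. 1; [MazurRubin2007] §3, Prop 4.1,
Def 4.3; [SilvermanAEC2009] VIII.§2.
-/


set_option autoImplicit false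
-- the Theorems namespace of this sub repeats the summit name by design (D-0017 nested layout)
set_option linter.dupNamespace false

noncomputable section

open scoped Classical

namespace Summit.BirchSwinnertonDyer.BirchSwinnertonDyer.Theorems.GenusExact.PlusDescent.SocleSelection

open WeierstrassCurve NumberField IsDedekindDomain Field
open Literature.NumberTheory.EllipticCurves Literature.NumberTheory.GaloisRepresentations
open Summit.BirchSwinnertonDyer.Rank1Residual.F1Sign2 (DescAdmissible NoRationalTwoTorsion IsQuadraticCharacterOf
  selmerGroupRelaxedAtInfinityAtTwo selmerGroup_le_selmerGroupRelaxedAtInfinityAtTwo mem_selmerGroupRelaxedAtInfinityAtTwo_iff)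
open Summit.BirchSwinnertonDyer.Rank1Residual.X11b.KummerPT (kummerStrict)
open Summit.BirchSwinnertonDyer.BirchSwinnertonDyer.Theorems.GenusKolyArch
open Summit.BirchSwinnertonDyer.BirchSwinnertonDyer.Theorems.GenusSupplyNarrow.KFourPosCell
open Summit.BirchSwinnertonDyer.BirchSwinnertonDyer.Theorems.RankOneAtTwoOneDoor (mem_torsionLocalKer_completion_iff)


/-! ## §3b The capitulation kernel IS the real-trivial line (both directions, element form) -/

/-- `E(K)[2] = 0` (in `(2 : ℤ) •` form) for `ρ̄_{E,2}` onto and `K` imaginary quadratic. [cite: DokchitserDokchitserMathZ2012, Theorem (1)] -/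
private theorem two_zsmul_eq_zero_imp (W : WeierstrassCurve ℚ) [W.IsElliptic] {K : Type} [Field K] [NumberField K]
    (hρ : W.HasSurjectiveModNGaloisRep 2) (hK : IsImaginaryQuadratic K) (T : (W.baseChange K).toAffine.Point) (hT2 : (2 : ℤ) • T = 0) :
    T = 0 := by
  have hmem : T ∈ AddSubgroup.torsionBy (W.baseChange K).toAffine.Point (2 : ℤ) := (Submodule.mem_torsionBy_iff _ T).mpr hT2
  rw [torsionBy_two_baseChange_eq_bot_of_hasSurjectiveModNGaloisRep_two_of_isImaginaryQuadratic W hρ K hK] at hmem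
  exact AddSubgroup.mem_bot.mp hmem


section CapitulationKernel

variable (W : WeierstrassCurve ℚ) [W.IsElliptic] [W.IsGloballyMinimal] {K : Type} [Field K] [NumberField K]

/-- **A non-zero REAL-TRIVIAL `2`-Selmer class restricts to `κ₂(Q₀)`** for ANY `Q₀ ∈ E(K) ∖ 2E(K)` (shallow frame, `2` split, `rank Wd(ℚ) = rank E(K) = 1`:
file 1 §3 + the rank-one Kummer dichotomy + injectivity of `res_K`).  BSD is NOT proved by this. [cite: Kramer1981, Thm. 1] [cite: GrossLMS1991, §5 (5.1)] -/
theorem resTorsion_eq_kummer_of_realTrivial [NeZero (W.conductorNorm ℤ)] (hΔ : 0 < W.Δ) (hρ : W.HasSurjectiveModNGaloisRep 2)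
    (hTam : Odd W.tamagawaProduct) (h4 : Nat.card (W.selmerGroup 2) = 4) (hK : IsImaginaryQuadratic K) (hodd : Odd (discr K))
    (hH : SatisfiesHeegnerHypothesis (W.conductorNorm ℤ) K) (h2K : ((Ideal.span {(2 : ℤ)}).primesOver (𝓞 K)).ncard = 2)
    {Wd : WeierstrassCurve ℚ} [Wd.IsElliptic] (Cd : VariableChange ℚ) (hCd : Cd • W.quadraticTwist (discr K : ℚ) = Wd)
    (hDEF : padicValNat 2 Wd.tamagawaProduct = 0) (hSel : Nat.card (Wd.selmerGroup 2) = 2) (hrank : Wd.mordellWeilRank = 1)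
    (hrkK : (W.baseChange K).mordellWeilRank = 1)
    {Q₀ : (W.baseChange K).toAffine.Point} (hQ₀ : ¬ ∃ R : (W.baseChange K).toAffine.Point, (2 : ℤ) • R = Q₀)
    {s : galH1Torsion W ((2 : ℕ) : ℤ)} (hs : s ∈ W.selmerGroup ((2 : ℕ) : ℤ)) (hs0 : s ≠ 0)
    (hinf : ∀ w : InfinitePlace ℚ, s ∈ W.torsionLocalKer w.Completion ((2 : ℕ) : ℤ)) :
    resTorsion W K ((2 : ℕ) : ℤ) s = kummerMapTorsion (W.baseChange K) ((2 : ℕ) : ℤ) (hdiv_two_baseChange W K) Q₀ := by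
  haveI : (W.baseChange K).IsElliptic := inferInstanceAs (W.map (algebraMap ℚ K)).IsElliptic
  have h2 : Module.finrank ℚ K = 2 := hK.1
  obtain ⟨θ, hθ, hθc⟩ := exists_sq_eq_discr_not_mem_range K h2
  have hT : NoRationalTwoTorsion W := GenusKolyTwin.noRationalTwoTorsion_of_hasSurjectiveModNGaloisRep W (by simpa using hρ)
  obtain ⟨χ, hχ⟩ := GenusKolyTransp.quadraticCharacterExists_holds (discr K)
  have h2Kt := two_zsmul_eq_zero_imp W hρ hK
  have hsT : s ∈ PrimeTwist.selmerGroup W χ :=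
    (realTrivial_iff_mem_primeTwist_selmerGroup W hΔ hρ hTam h4 hK hodd hH h2K Cd hCd hDEF hSel hχ s).mp ⟨hs, hinf⟩
  obtain ⟨Q', hQ'⟩ := resTorsion_mem_range_kummer_of_mem_primeTwist_selmerGroup W (K := K) hT (NumberField.discr_ne_zero K)
    ⟨θ, hθc⟩ Cd hCd hrank hSel hχ hsT
  have hresne : resTorsion W K ((2 : ℕ) : ℤ) s ≠ 0 := fun h0 ↦ hs0
    (GenusExact.EigenClassesFinite.resTorsion_injective_of_noTorsion W K h2 hθ hθc ((2 : ℕ) : ℤ) h2Kt (by rw [h0, map_zero]))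
  rcases kummerMapTorsion_eq_zero_or_eq_of_rank_one W K hrkK h2Kt hQ₀ Q' with h0 | h1
  · exact absurd (hQ'.symm.trans h0) hresne
  · rw [← hQ', h1]

/-- **Conversely, the UNIQUE descent `s_y` of `κ₂(Q₀)` (gk2-p5 `KFourPosCell.existsUnique_resTorsion_eq_kummer_of_kFourPos`, p767715) is a REAL-TRIVIAL
`2`-Selmer class**: the real-trivial line has exactly two elements (file 1 `natCard_realTrivial_eq_two`), its non-zero element restricts to `κ₂(Q₀)`
(`resTorsion_eq_kummer_of_realTrivial`), and `res_K` is injective.  So on the shallow frame CAPITULATION KERNEL = REAL-TRIVIAL LINE = TWIN'S SELMER GROUP.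
BSD is NOT proved by this. [cite: Kramer1981, Thm. 1] [cite: GrossLMS1991, §5 (5.1)] -/
theorem realTrivial_of_resTorsion_eq_kummer [NeZero (W.conductorNorm ℤ)] (hΔ : 0 < W.Δ) (hρ : W.HasSurjectiveModNGaloisRep 2)
    (hTam : Odd W.tamagawaProduct) (h4 : Nat.card (W.selmerGroup 2) = 4) (hK : IsImaginaryQuadratic K) (hodd : Odd (discr K))
    (hH : SatisfiesHeegnerHypothesis (W.conductorNorm ℤ) K) (h2K : ((Ideal.span {(2 : ℤ)}).primesOver (𝓞 K)).ncard = 2)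
    {Wd : WeierstrassCurve ℚ} [Wd.IsElliptic] (Cd : VariableChange ℚ) (hCd : Cd • W.quadraticTwist (discr K : ℚ) = Wd)
    (hDEF : padicValNat 2 Wd.tamagawaProduct = 0) (hSel : Nat.card (Wd.selmerGroup 2) = 2) (hrank : Wd.mordellWeilRank = 1)
    (hrkK : (W.baseChange K).mordellWeilRank = 1)
    {Q₀ : (W.baseChange K).toAffine.Point} (hQ₀ : ¬ ∃ R : (W.baseChange K).toAffine.Point, (2 : ℤ) • R = Q₀)
    {s : galH1Torsion W ((2 : ℕ) : ℤ)}
    (hs : resTorsion W K ((2 : ℕ) : ℤ) s = kummerMapTorsion (W.baseChange K) ((2 : ℕ) : ℤ) (hdiv_two_baseChange W K) Q₀) :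
    s ∈ W.selmerGroup ((2 : ℕ) : ℤ) ∧ ∀ w : InfinitePlace ℚ, s ∈ W.torsionLocalKer w.Completion ((2 : ℕ) : ℤ) := by
  haveI : (W.baseChange K).IsElliptic := inferInstanceAs (W.map (algebraMap ℚ K)).IsElliptic
  have h2 : Module.finrank ℚ K = 2 := hK.1
  obtain ⟨θ, hθ, hθc⟩ := exists_sq_eq_discr_not_mem_range K h2
  have h2Kt := two_zsmul_eq_zero_imp W hρ hK
  have hcard := natCard_realTrivial_eq_two W hΔ hρ hTam h4 hK hodd hH h2K Cd hCd hDEF hSel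
  have h0mem : (0 : galH1Torsion W ((2 : ℕ) : ℤ)) ∈ W.selmerGroup ((2 : ℕ) : ℤ) ∧
      ∀ w : InfinitePlace ℚ, (0 : galH1Torsion W ((2 : ℕ) : ℤ)) ∈ W.torsionLocalKer w.Completion ((2 : ℕ) : ℤ) :=
    ⟨AddSubgroup.zero_mem _, fun w ↦ AddSubgroup.zero_mem _⟩
  obtain ⟨t, ht, -⟩ := (Nat.card_eq_two_iff' (⟨0, h0mem⟩ : {s : galH1Torsion W ((2 : ℕ) : ℤ) //
      s ∈ W.selmerGroup ((2 : ℕ) : ℤ) ∧ ∀ w : InfinitePlace ℚ, s ∈ W.torsionLocalKer w.Completion ((2 : ℕ) : ℤ)})).mp hcard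
  have ht0 : (t : galH1Torsion W ((2 : ℕ) : ℤ)) ≠ 0 := fun h ↦ ht (Subtype.ext h)
  have hrest := resTorsion_eq_kummer_of_realTrivial W hΔ hρ hTam h4 hK hodd hH h2K Cd hCd hDEF hSel hrank hrkK hQ₀ t.2.1 ht0 t.2.2
  have hst : s = t :=
    GenusExact.EigenClassesFinite.resTorsion_injective_of_noTorsion W K h2 hθ hθc ((2 : ℕ) : ℤ) h2Kt (by rw [hs, hrest])
  rw [hst]
  exact t.2

end CapitulationKernel

/-! ## §4 LINE 27 S2, conjunct (SOC) — VERBATIM + the clause «`2` split in `K`» -/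

section SOC

open Summit.BirchSwinnertonDyer.BirchSwinnertonDyer.Theses.GenusKolyvaginAtTwo (MultPublishedInputsAtTwo)
open Literature.NumberTheory.EllipticCurves.ModularForms Literature.NumberTheory.EllipticCurves.KolyvaginCocycle

universe u

/-- Socle uniqueness in a cyclic `2`-group: if `2^k • w` has order exactly `2` (`w` of `2`-power order), every `m • w` killed by `2` is `0`
or `2^k • w`.  (Adapted from the LINE 27 skeleton's `zsmul_eq_zero_or_eq_socle`, bsd-idea-1 g25, kernel-checked there.) [folklore] -/
private theorem zsmul_eq_zero_or_eq_socle {A : Type*} [AddCommGroup A] {n : ℕ} (w : A)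
    (hw : ((2 ^ n : ℕ) : ℤ) • w = 0) (k : ℕ) (hne : ((2 ^ k : ℕ) : ℤ) • w ≠ 0)
    (h2 : (2 : ℤ) • (((2 ^ k : ℕ) : ℤ) • w) = 0) (m : ℤ) (hm : (2 : ℤ) • (m • w) = 0) :
    m • w = 0 ∨ m • w = ((2 ^ k : ℕ) : ℤ) • w := by
  have ho : addOrderOf w ∣ 2 ^ n := by
    rw [natCast_zsmul] at hw
    exact addOrderOf_dvd_iff_nsmul_eq_zero.2 hw
  have hk : ¬ addOrderOf w ∣ 2 ^ k := by
    intro h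
    apply hne
    rw [natCast_zsmul]
    exact addOrderOf_dvd_iff_nsmul_eq_zero.1 h
  have hk1 : addOrderOf w ∣ 2 ^ (k + 1) := by
    apply addOrderOf_dvd_iff_nsmul_eq_zero.2
    have h2' : (2 : ℕ) • (((2 ^ k : ℕ) : ℤ) • w) = 0 := by
      rw [two_nsmul]; rw [two_zsmul] at h2; exact h2
    rw [natCast_zsmul] at h2'
    rw [pow_succ', mul_smul]
    exact h2'
  obtain ⟨e, -, hoe⟩ := (Nat.dvd_prime_pow Nat.prime_two).1 ho
  rw [hoe] at hk hk1
  have he1 : e ≤ k + 1 := (Nat.pow_dvd_pow_iff_le_right (by norm_num)).1 hk1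
  have he2 : ¬ e ≤ k := fun h ↦ hk ((Nat.pow_dvd_pow_iff_le_right (by norm_num)).2 h)
  have he : e = k + 1 := by omega
  have hdvd : ((addOrderOf w : ℕ) : ℤ) ∣ 2 * m := by
    apply addOrderOf_dvd_iff_zsmul_eq_zero.2
    rw [mul_smul]; exact hm
  rw [hoe, he] at hdvd
  push_cast at hdvd
  rw [pow_succ'] at hdvd
  obtain ⟨m', rfl⟩ := (mul_dvd_mul_iff_left (two_ne_zero : (2 : ℤ) ≠ 0)).1 hdvd
  have hσ : ((2 ^ k : ℕ) : ℤ) • w + ((2 ^ k : ℕ) : ℤ) • w = 0 := by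
    rw [← two_zsmul]; exact h2
  have hmw : (2 ^ k * m') • w = m' • (((2 ^ k : ℕ) : ℤ) • w) := by
    push_cast
    rw [mul_comm, mul_smul]
  rw [hmw]
  rcases Int.even_or_odd m' with ⟨r, hr⟩ | ⟨r, hr⟩
  · left
    rw [hr, add_smul, ← smul_add, hσ, smul_zero]
  · right
    rw [hr, add_smul, one_smul, mul_smul, two_zsmul, ← smul_add, hσ, smul_zero, zero_add]

/-- In a `2`-power-torsion group, an integer multiple `k • x` of order exactly `2` is a POWER-OF-`2` multiple `2^i • x`. [folklore] -/
private theorem exists_pow_zsmul_eq_of_zsmul_eq {A : Type*} [AddCommGroup A] {n : ℕ} (x : A)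
    (hx : ((2 ^ n : ℕ) : ℤ) • x = 0) (k : ℤ) (hσ : k • x ≠ 0) (h2 : (2 : ℤ) • (k • x) = 0) :
    ∃ i : ℕ, ((2 ^ i : ℕ) : ℤ) • x = k • x := by
  -- the additive order of `x` is `2^e`, `e ≥ 1`
  have ho : addOrderOf x ∣ 2 ^ n := by
    rw [natCast_zsmul] at hx
    exact addOrderOf_dvd_iff_nsmul_eq_zero.2 hx
  obtain ⟨e, -, hoe⟩ := (Nat.dvd_prime_pow Nat.prime_two).1 ho
  have hx0 : x ≠ 0 := by rintro rfl; exact hσ (smul_zero k)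
  have he : e ≠ 0 := by
    rintro rfl
    rw [pow_zero, AddMonoid.addOrderOf_eq_one_iff] at hoe
    exact hx0 hoe
  obtain ⟨f, rfl⟩ : ∃ f, e = f + 1 := ⟨e - 1, by omega⟩
  refine ⟨f, ?_⟩
  have hne : ((2 ^ f : ℕ) : ℤ) • x ≠ 0 := by
    intro h
    rw [natCast_zsmul] at h
    have hd := addOrderOf_dvd_iff_nsmul_eq_zero.2 h
    rw [hoe, Nat.pow_dvd_pow_iff_le_right (by norm_num)] at hd
    omega
  have h2f : (2 : ℤ) • (((2 ^ f : ℕ) : ℤ) • x) = 0 := by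
    rw [smul_smul, show (2 : ℤ) * ((2 ^ f : ℕ) : ℤ) = ((2 ^ (f + 1) : ℕ) : ℤ) by push_cast; ring, ← hoe, natCast_zsmul,
      addOrderOf_nsmul_eq_zero]
  rcases zsmul_eq_zero_or_eq_socle x hx f hne h2f k h2 with h | h
  · exact absurd h hσ
  · exact h.symm

/-- `ι ∘ ι = ι` for the change-of-level maps `torsionH1OfDvd` (functoriality in compatible pairs). [cite: SerreGaloisCohomology1997, I.§2.4] -/
private theorem torsionH1OfDvd_torsionH1OfDvd {K₀ : Type u} [Field K₀] (V : WeierstrassCurve K₀) {d m n : ℤ}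
    (h₁ : d ∣ m) (h₂ : m ∣ n) (x : galH1Torsion V d) :
    torsionH1OfDvd V h₂ (torsionH1OfDvd V h₁ x) = torsionH1OfDvd V (h₁.trans h₂) x := by
  unfold torsionH1OfDvd
  rw [resH1Hom_resH1Hom]
  exact congrFun (congrArg DFunLike.coe (resH1Hom_congr (by ext; rfl) (by ext; rfl) _ _)) x

/-- **`k • κ_n(Q) = ι_* κ_d(Q)` for `n = k·d`** (the Kummer classes of ONE rational point at two levels; McCallum's Lemma 4.6 for the trivial
`(σ−1)`-correction), through any `n`-admissible `A ∋ Q`. [cite: McCallumLMS1991, §4 Lemma 4.6] [cite: SilvermanAEC2009, VIII.§2] -/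
private theorem zsmul_kummerMapTorsion_eq_torsionH1OfDvd {K₀ : Type u} [Field K₀] (V : WeierstrassCurve K₀)
    {A : AddSubgroup (geomPoints V)} {n d : ℤ} (k : ℤ) (hn : n = k * d)
    (hA : IsAdmissible (absoluteGaloisGroup K₀) A n) (hAd : IsAdmissible (absoluteGaloisGroup K₀) A d)
    (hdivn : ∀ P : geomPoints V, ∃ Q : geomPoints V, n • Q = P) (hdivd : ∀ P : geomPoints V, ∃ Q : geomPoints V, d • Q = P)
    (Q : V.toAffine.Point) (hQ : toGeomPoints V Q ∈ A) :
    k • kummerMapTorsion V n hdivn Q = torsionH1OfDvd V (Dvd.intro_left k hn.symm) (kummerMapTorsion V d hdivd Q) := by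
  have hPn : toGeomPoints V Q ∈ invPoints (absoluteGaloisGroup K₀) A n :=
    mem_invPoints_of_fixed hQ fun g ↦ toGeomPoints_mem_fixedPoints V Q g
  have hPd : toGeomPoints V Q ∈ invPoints (absoluteGaloisGroup K₀) A d :=
    mem_invPoints_of_fixed hQ fun g ↦ toGeomPoints_mem_fixedPoints V Q g
  obtain ⟨R, hR⟩ := hdivn (toGeomPoints V Q)
  have hRd : d • (k • R) = toGeomPoints V Q := by rw [smul_smul, mul_comm, ← hn, hR]
  rw [← kolyvaginClass_toGeomPoints (hdiv := hdivn) hA Q hPn, ← kolyvaginClass_toGeomPoints (hdiv := hdivd) hAd Q hPd,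
    kolyvaginClass_eq_cls hA hPn hR, kolyvaginClass_eq_cls hAd hPd hRd,
    GenusExact.KolyvaginClassLevels.zsmul_cls_eq_map_torsionInclusion_cls V k hn hA hAd hPn hPd hR hRd, map_torsionInclusion_one_apply]

variable (W : WeierstrassCurve ℚ) [W.IsElliptic] [W.IsGloballyMinimal] {K : Type} [Field K] [NumberField K]

/-- **THE HEEGNER SOCLE** on the frame: for a conductor-`1` datum `d₁` with `2^{M₀} ∥ P(1)` in `E(K[1])`, `P₀ ∈ E(K)` under `P(1)`, `2^{M₀} Q₀ = P₀`, and
`M₀ + 1 ≤ M`: `2^(M − M₀ − 1) • ι_{M→M+1} c_M(1) = ι_{1→M+1} κ₂(Q₀)` (`c_M(1) = κ_{2^M}(P₀) = 2^{M₀} κ_{2^M}(Q₀)`; McCallum Lemma 4.6).  BSD is NOT proved by this.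
[cite: GrossLMS1991, §4 (4.4)] [cite: McCallumLMS1991, §4 (6), Lemma 4.6] -/
theorem pow_zsmul_kolyvaginClass_one_eq_torsionH1OfDvd_kummer [NeZero (W.conductorNorm ℤ)] (hIQ : IsImaginaryQuadratic K)
    (hodd : Odd (discr K)) (hHe : SatisfiesHeegnerHypothesis (W.conductorNorm ℤ) K) (hsurj : W.HasSurjectiveModNGaloisRep ((2 : ℤ) ^ 1))
    {Dt : ModularParametrizationData W (W.conductorNorm ℤ)} {β : ℤ} {ι : K →+* ℂ} (d₁ : KolyvaginHeegnerData Dt β ι 1)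
    {P₀ Q₀ : (W.baseChange K).toAffine.Point}
    (hP₀ : WeierstrassCurve.Affine.Point.map (W' := W) (algebraMap K (ringClassField K ι 1)).toRatAlgHom P₀ = d₁.derivedPoint)
    {M₀ M : ℕ} (hQ₀ : ((2 ^ M₀ : ℕ) : ℤ) • Q₀ = P₀) (hM : M₀ + 1 ≤ M)
    (hdvd : ((2 ^ M : ℕ) : ℤ) ∣ ((2 ^ (M + 1) : ℕ) : ℤ)) (h1 : ((2 : ℕ) : ℤ) ∣ ((2 ^ (M + 1) : ℕ) : ℤ)) :
    ((2 ^ (M - (M₀ + 1)) : ℕ) : ℤ) • torsionH1OfDvd (W.baseChange K) hdvd (d₁.kolyvaginClass Nat.prime_two M) =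
      torsionH1OfDvd (W.baseChange K) h1 (kummerMapTorsion (W.baseChange K) ((2 : ℕ) : ℤ) (hdiv_two_baseChange W K) Q₀) := by
  have hA : ∀ L : ℕ, IsAdmissible (absoluteGaloisGroup K) d₁.pointsSubgroup ((2 ^ L : ℕ) : ℤ) :=
    fun L ↦ GenusKoly.isAdmissible_pointsSubgroup_two hIQ hodd hHe hsurj one_ne_zero d₁ L
  have hgeom : d₁.toGeomPoints d₁.derivedPoint = toGeomPoints (W.baseChange K) P₀ := by
    rw [← hP₀]; exact Summit.BirchSwinnertonDyer.Rank1Residual.X11b.KolyvaginBottom.toGeomPoints_map_algebraMap d₁ P₀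
  have hP : ∀ L : ℕ, d₁.toGeomPoints d₁.derivedPoint ∈ invPoints (absoluteGaloisGroup K) d₁.pointsSubgroup ((2 ^ L : ℕ) : ℤ) :=
    fun L ↦ mem_invPoints_of_fixed ⟨d₁.derivedPoint, rfl⟩ fun g ↦ by
      rw [hgeom]; exact toGeomPoints_mem_fixedPoints (W.baseChange K) P₀ g
  -- Lemma 4.6: `2^(M − (M₀+1)) • c_M(1) = ι_{M₀+1→M} c_{M₀+1}(1)`
  have hMM : ((2 ^ (M₀ + 1) : ℕ) : ℤ) ∣ ((2 ^ M : ℕ) : ℤ) := GenusExact.KolyvaginClassLevels.natCast_pow_dvd_natCast_pow hM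
  have h46 := GenusExact.KolyvaginClassLevels.zsmul_kolyvaginClass_eq_torsionH1OfDvd d₁ Nat.prime_two hM (hA M) (hP M) hMM
  -- `c_{M₀+1}(1) = κ_{2^(M₀+1)}(P₀) = 2^{M₀} • κ(Q₀) = ι_{1→M₀+1} κ₂(Q₀)`
  have hc1 := GenusExact.VisiblePairAtTwo.kolyvaginClass_one_two_eq_kummerMapTorsion W K hIQ hodd hHe hsurj (M₀ + 1) d₁ P₀ hP₀
  have hQmem : toGeomPoints (W.baseChange K) Q₀ ∈ d₁.pointsSubgroup := by
    rw [← Summit.BirchSwinnertonDyer.Rank1Residual.X11b.KolyvaginBottom.toGeomPoints_map_algebraMap d₁ Q₀]; exact ⟨_, rfl⟩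
  have hsplit : ((2 ^ (M₀ + 1) : ℕ) : ℤ) = ((2 ^ M₀ : ℕ) : ℤ) * ((2 : ℕ) : ℤ) := by push_cast; ring
  have hA1 : IsAdmissible (absoluteGaloisGroup K) d₁.pointsSubgroup ((2 : ℕ) : ℤ) := by
    have h := hA 1; rwa [pow_one] at h
  have hkum := zsmul_kummerMapTorsion_eq_torsionH1OfDvd (W.baseChange K) ((2 ^ M₀ : ℕ) : ℤ) hsplit (hA (M₀ + 1)) hA1
    ((W.baseChange K).zsmul_geomPoints_surjective_of_charZero (by exact_mod_cast pow_ne_zero (M₀ + 1) two_ne_zero))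
    (hdiv_two_baseChange W K) Q₀ hQmem
  rw [← map_zsmul, h46, hc1, ← hQ₀, map_zsmul, hkum, torsionH1OfDvd_torsionH1OfDvd, torsionH1OfDvd_torsionH1OfDvd]

/-- **LINE 27 S2, conjunct (SOC), on the `2`-SPLIT half of the frame** — the statement of `stub_shallowFrameSocle`'s (SOC) VERBATIM, with the ONE extra
binder `((Ideal.span {2}).primesOver (𝓞 K)).ncard = 2` (the K₄⁺ prime-frame clause) inserted after the two non-square clauses.  For `M ≥ M₀ + 1`
and `s₀ ∈ Sel_(2^M)(E/ℚ)` whose socle is (the level-raise of) a non-zero REAL-TRIVIAL class `c`, the lines `⟨ι res_K s₀⟩` and `⟨ι c_M(1)⟩` SHARE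
THEIR SOCLE one level up: both socles are `ι_{1→M+1} κ₂(y_K/2^{M₀})`.  Proof: `c ∈ Sel₂(E)` (level-stability of the local kernels), so `c` is THE
capitulating class (§2–§3: `res_K c = κ₂(Q₀)`, rank `E(K) = 1` by print on `E` and `Wd`), and the Heegner socle is `ι κ₂(Q₀)`
(`pow_zsmul_kolyvaginClass_one_eq_torsionH1OfDvd_kummer`).  PRINT used: `MultPublishedInputsAtTwo` (ranks `0 + 1`).  BSD is NOT proved by this; S2's (HL)
conjunct and the `2`-inert half remain.  [cite: Kramer1981, Thm. 1] [cite: GrossLMS1991, §4 (4.4), §5 (5.1)] [cite: McCallumLMS1991, §4 Lemma 4.6, §5 Lemma 5.1]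
[cite: MazurRubin2007, §3, Prop 4.1, Def 4.3] -/
theorem sharedSocle_of_realTrivialSocle_of_splitTwo :
    ∀ (W : WeierstrassCurve ℚ) [W.IsElliptic] [W.IsGloballyMinimal] [NeZero (W.conductorNorm ℤ)],
      W.analyticRank = 0 → (∀ n : ℕ, 0 < n → W.HasSurjectiveModNGaloisRep ((2 : ℤ) ^ n)) → Odd W.tamagawaProduct → 0 < W.Δ →
      ∀ (K : Type) [Field K] [NumberField K], IsImaginaryQuadratic K → Odd (NumberField.discr K) → NumberField.discr K ≠ -3 →
        SatisfiesHeegnerHypothesis (W.conductorNorm ℤ) K →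
        ¬ IsSquare ((NumberField.discr K : ℚ) * -|W.Δ|) → ¬ IsSquare ((NumberField.discr K : ℚ) * (-(2 * |W.Δ|))) →
        ((Ideal.span {(2 : ℤ)}).primesOver (𝓞 K)).ncard = 2 →
      ∀ (Dt : ModularParametrizationData W (W.conductorNorm ℤ)),
        (∀ z ∈ Dt.L.lattice, ∃ w ∈ periodLattice Dt.f, z = (Dt.c : ℂ) * w) → Odd Dt.c →
      ∀ (β : ℤ) (ι : K →+* ℂ) (d₁ : KolyvaginHeegnerData Dt β ι 1), ¬ IsOfFinAddOrder d₁.derivedPoint →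
      ∀ (M₀ : ℕ), (∃ Q : (W.baseChange (ringClassField K ι 1)).toAffine.Point, ((2 ^ M₀ : ℕ) : ℤ) • Q = d₁.derivedPoint) →
        (¬ ∃ Q : (W.baseChange (ringClassField K ι 1)).toAffine.Point, ((2 ^ (M₀ + 1) : ℕ) : ℤ) • Q = d₁.derivedPoint) →
      ∀ (Wd : WeierstrassCurve ℚ) [Wd.IsElliptic] [Wd.IsGloballyMinimal],
        (∃ C : WeierstrassCurve.VariableChange ℚ, C • W.quadraticTwist (NumberField.discr K : ℚ) = Wd) →
        Wd.analyticRank = 1 → Nat.card (Wd.selmerGroup 2) = 2 → padicValNat 2 Wd.tamagawaProduct = 0 →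
      Nat.card (W.selmerGroup 2) = 4 → MultPublishedInputsAtTwo →
      (∀ (M : ℕ), M₀ + 1 ≤ M → ∀ (s₀ : galH1Torsion W ((2 ^ M : ℕ) : ℤ)), s₀ ∈ selmerGroup W ((2 ^ M : ℕ) : ℤ) →
          (∃ c : galH1Torsion W 2, c ≠ 0 ∧ (∀ w : InfinitePlace ℚ, c ∈ W.torsionLocalKer w.Completion 2) ∧
            ∀ hdvd₁ : (2 : ℤ) ∣ ((2 ^ M : ℕ) : ℤ), torsionH1OfDvd W hdvd₁ c ∈ AddSubgroup.zmultiples s₀) →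
          ∀ (hdvd : ((2 ^ M : ℕ) : ℤ) ∣ ((2 ^ (M + 1) : ℕ) : ℤ)), ∃ i j : ℕ,
            ((2 ^ i : ℕ) : ℤ) • torsionH1OfDvd (W.baseChange K) hdvd (resTorsion W K ((2 ^ M : ℕ) : ℤ) s₀) =
              ((2 ^ j : ℕ) : ℤ) • torsionH1OfDvd (W.baseChange K) hdvd (d₁.kolyvaginClass Nat.prime_two M) ∧
            ((2 ^ j : ℕ) : ℤ) • torsionH1OfDvd (W.baseChange K) hdvd (d₁.kolyvaginClass Nat.prime_two M) ≠ 0 ∧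
            (2 : ℤ) • (((2 ^ j : ℕ) : ℤ) • torsionH1OfDvd (W.baseChange K) hdvd (d₁.kolyvaginClass Nat.prime_two M)) = 0) := by
  intro W _ _ _ hr0 hρ hTam hpos K _ _ hIQ hodd _h3 hHe _hsq1 _hsq2 h2K Dt _hopt _hc β ι d₁ _hy M₀ hdiv hndiv Wd _ _ hWd hrd hSel hDEF
    h4 hGZK M hM s₀ hs₀ hsoc hdvd
  obtain ⟨c, hc0, hcinf, hcz⟩ := hsoc
  haveI : (W.baseChange K).IsElliptic := inferInstanceAs (W.map (algebraMap ℚ K)).IsElliptic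
  have h2 : Module.finrank ℚ K = 2 := hIQ.1
  obtain ⟨θ, hθ, hθc⟩ := exists_sq_eq_discr_not_mem_range K h2
  have hsurj1 : W.HasSurjectiveModNGaloisRep ((2 : ℤ) ^ 1) := hρ 1 one_pos
  have hρ2 : W.HasSurjectiveModNGaloisRep 2 := by simpa using hsurj1
  have hT : NoRationalTwoTorsion W := GenusKolyTwin.noRationalTwoTorsion_of_hasSurjectiveModNGaloisRep W hsurj1
  obtain ⟨Cd, hCd⟩ := hWd
  obtain ⟨χ, hχ⟩ := GenusKolyTransp.quadraticCharacterExists_holds (discr K)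
  -- ranks from print: `rank E(ℚ) = 0`, `rank Wd(ℚ) = 1`, hence `rank E(K) = 1`
  have hrkW : W.mordellWeilRank = 0 := by rw [(hGZK W (by rw [hr0]; exact zero_le_one)).1, hr0]
  have hrkWd : Wd.mordellWeilRank = 1 := by rw [(hGZK Wd (by rw [hrd])).1, hrd]
  have hrkTw : (W.quadraticTwist (discr K : ℚ)).mordellWeilRank = 1 := by
    rw [← mordellWeilRank_variableChange_holds (W.quadraticTwist (discr K : ℚ)) Cd, hCd, hrkWd]
  have hrkK : (W.baseChange K).mordellWeilRank = 1 := by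
    rw [mordellWeilRank_baseChange_eq_add_of_sq_eq W K h2 hθ hθc, hrkW, hrkTw]
  -- `E(K)[2] = 0`
  have hbotK : AddSubgroup.torsionBy (W.baseChange K).toAffine.Point (2 : ℤ) = ⊥ :=
    torsionBy_two_baseChange_eq_bot_of_hasSurjectiveModNGaloisRep_two_of_isImaginaryQuadratic W hρ2 K hIQ
  have h2Kt := two_zsmul_eq_zero_imp W hρ2 hIQ
  -- (A1) narrowness, then gk2-p5's capitulation package on the K₄⁺ cell: `P₀`, `Q₀ = P₀/2^{M₀} ∉ 2E(K)`
  have hnar := exists_localization_ne_zero_of_shallowTwin W hpos hρ2 hTam h4 hIQ hodd hHe h2K Cd hCd hDEF hSel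
  have hdneg : (discr K : ℚ) < 0 := by exact_mod_cast IsImaginaryQuadratic.discr_neg hIQ
  have hsqΔ : ¬ IsSquare ((NumberField.discr K : ℚ) * W.Δ) := by
    rintro ⟨r, hr⟩
    nlinarith [mul_self_nonneg r, mul_neg_of_neg_of_pos hdneg hpos]
  obtain ⟨P₀, Q₀, -, hP₀, hQ₀, hQ₀nd, -, -⟩ := existsUnique_resTorsion_eq_kummer_of_depth_pos W K hpos hρ2 hTam hnar hIQ hodd hHe h2K Cd hCd
    hDEF (sigmaQ_ne_one K h2 hθ hθc) hr0 hsqΔ Dt β ι d₁ hdiv hndiv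
  -- Step 1: `c ∈ Sel₂(E)` (level-stability of the local kernels; `ι c ∈ ℤ s₀ ⊆ Sel_(2^M)`)
  have hM1 : 1 ≤ M := by omega
  have hdvd₁ : (2 : ℤ) ∣ ((2 ^ M : ℕ) : ℤ) := by
    rw [show M = (M - 1) + 1 by omega, pow_succ]; push_cast; exact Dvd.intro_left _ rfl
  obtain ⟨k, hk⟩ := AddSubgroup.mem_zmultiples_iff.mp (hcz hdvd₁)
  have hιc : torsionH1OfDvd W hdvd₁ c ∈ selmerGroup W ((2 ^ M : ℕ) : ℤ) := by
    rw [← hk]; exact AddSubgroup.zsmul_mem _ hs₀ k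
  have hcSel : c ∈ W.selmerGroup ((2 : ℕ) : ℤ) := by
    rw [mem_selmerGroup_iff] at hιc ⊢
    exact ⟨fun v ↦ (GenusExact.VisiblePairAtTwo.torsionH1OfDvd_mem_selmerLocalKer_iff W _ hdvd₁ c).mpr (hιc.1 v),
      fun w ↦ (GenusExact.VisiblePairAtTwo.torsionH1OfDvd_mem_selmerLocalKer_iff W _ hdvd₁ c).mpr (hιc.2 w)⟩
  -- Step 2: `c` is in the twin's Selmer group, hence capitulates: `res_K c = κ₂(Q₀)`
  have hcT : c ∈ PrimeTwist.selmerGroup W χ :=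
    (realTrivial_iff_mem_primeTwist_selmerGroup W hpos hρ2 hTam h4 hIQ hodd hHe h2K Cd hCd hDEF hSel hχ c).mp ⟨hcSel, hcinf⟩
  obtain ⟨Q', hQ'⟩ := resTorsion_mem_range_kummer_of_mem_primeTwist_selmerGroup W (K := K) hT (NumberField.discr_ne_zero K)
    ⟨θ, hθc⟩ Cd hCd hrkWd hSel hχ hcT
  have hresne : resTorsion W K ((2 : ℕ) : ℤ) c ≠ 0 := fun h0 ↦ hc0
    (GenusExact.EigenClassesFinite.resTorsion_injective_of_noTorsion W K h2 hθ hθc ((2 : ℕ) : ℤ) h2Kt (by rw [h0, map_zero]))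
  have hresc : resTorsion W K ((2 : ℕ) : ℤ) c = kummerMapTorsion (W.baseChange K) ((2 : ℕ) : ℤ) (hdiv_two_baseChange W K) Q₀ := by
    rcases kummerMapTorsion_eq_zero_or_eq_of_rank_one W K hrkK h2Kt hQ₀nd Q' with h0 | h1
    · exact absurd (hQ'.symm.trans h0) hresne
    · rw [← hQ', h1]
  have h1 : ((2 : ℕ) : ℤ) ∣ ((2 ^ (M + 1) : ℕ) : ℤ) := hdvd₁.trans hdvd
  set z : galH1Torsion (W.baseChange K) ((2 ^ (M + 1) : ℕ) : ℤ) :=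
    torsionH1OfDvd (W.baseChange K) h1 (kummerMapTorsion (W.baseChange K) ((2 : ℕ) : ℤ) (hdiv_two_baseChange W K) Q₀) with hz
  have hheeg := pow_zsmul_kolyvaginClass_one_eq_torsionH1OfDvd_kummer W hIQ hodd hHe hsurj1 d₁ hP₀ hQ₀ hM hdvd h1
  -- the Selmer side: `k • ι res s₀ = ι res (ι₁ c) = ι_{1→M+1} res c = z`
  have hsel : k • torsionH1OfDvd (W.baseChange K) hdvd (resTorsion W K ((2 ^ M : ℕ) : ℤ) s₀) = z := by
    rw [← map_zsmul, ← map_zsmul, hk, GenusExact.SelmerDescent.resTorsion_torsionH1OfDvd W K hdvd₁ c, torsionH1OfDvd_torsionH1OfDvd]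
    -- the levels `2` and `((2 : ℕ) : ℤ)` agree definitionally
    change torsionH1OfDvd (W.baseChange K) h1 (resTorsion W K ((2 : ℕ) : ℤ) c) = z
    rw [hresc, hz]
  -- `z ≠ 0` (`ι_{1→M+1}` injective over `K`, `res_K c ≠ 0`) and `2 • z = 0`
  have hz0 : z ≠ 0 := by
    intro h0
    have hbot' : AddSubgroup.torsionBy (W.baseChange K).toAffine.Point ((2 : ℕ) : ℤ) = ⊥ := hbotK
    have h1' : ((2 ^ 1 : ℕ) : ℤ) ∣ ((2 ^ (M + 1) : ℕ) : ℤ) := by simpa only [pow_one] using h1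
    have hinj := GenusExact.VisiblePairAtTwo.torsionH1OfDvd_pow_injective (W.baseChange K) (p := 2) hbot' h1'
    apply hresne
    apply hinj
    rw [map_zero, hresc]
    exact h0
  have hz2 : (2 : ℤ) • z = 0 := by
    rw [hz, ← map_zsmul, show (2 : ℤ) • kummerMapTorsion (W.baseChange K) ((2 : ℕ) : ℤ) (hdiv_two_baseChange W K) Q₀ = 0 from
      zsmul_galH1Torsion_eq_zero (W.baseChange K) _ _, map_zero]
  have hx2M : ((2 ^ (M + 1) : ℕ) : ℤ) • torsionH1OfDvd (W.baseChange K) hdvd (resTorsion W K ((2 ^ M : ℕ) : ℤ) s₀) = 0 :=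
    zsmul_galH1Torsion_eq_zero (W.baseChange K) _ _
  obtain ⟨i, hi⟩ := exists_pow_zsmul_eq_of_zsmul_eq _ hx2M k (by rw [hsel]; exact hz0) (by rw [hsel]; exact hz2)
  refine ⟨i, M - (M₀ + 1), ?_, ?_, ?_⟩
  · rw [hi, hsel, hheeg]
  · rw [hheeg]; exact hz0
  · rw [hheeg]; exact hz2

end SOC


end Summit.BirchSwinnertonDyer.BirchSwinnertonDyer.Theorems.GenusExact.PlusDescent.SocleSelection

end
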